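import Literature.NumberTheory.EllipticCurves.BhargavaShankarAveragingRegion
import Mathlib.Topology.Algebra.InfiniteSum.ENNReal
import HarnessLib

/-!
# The unfolding identity of the averaging method (Bhargava–Shankar §2.3, eqs. (5)–(7))

Topic `Literature/NumberTheory/EllipticCurves`; uses `BhargavaShankarAveragingRegion.lean`
(`G₀`, `avgSet`, the structure theorem and `μ(⋃ g₀σG₀) = |S| μ(G₀)`) and
`Literature/MeasureTheory/Group/GL2ZFundamentalDomain.lean` (`Γ = gl2zGL = GL₂(ℤ) ⊂ GL₂(ℝ)`, its
fundamental domain `gaussFD` for the Haar measure `haarSL2pm` of `SL₂^±(ℝ)`). Everything here is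
PROVED (no named facts).

Bhargava–Shankar (Ann. of Math. 181 (2015), §2.3 of `arXiv:1006.1002v2`) count `Γ`-orbits of
integral forms by averaging the number of lattice points of `g G₀ L` over `g` in a fundamental
domain `𝓕` and unfolding the integral: `N(V⁽ⁱ⁾; X) = (1/M) ∫_𝓕 #{x ∈ g G₀ L ∩ V_ℤ^{irr}} dg`
with `M = nᵢ μ(G₀)`-type constants (eqs. (5)–(7)). This file proves the unfolding in the form

* `Γ = gl2zGL` acts on `V_ℤ = BinaryQuartic ℤ` by substitution (`mulActionGL2Z`, orbits
  `= gl2zOrbit`, `orbit_eq_gl2zOrbit`);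
* `E(x) = {h ∈ SL₂^±(ℝ) : h⁻¹ · x_ℝ ∈ B(𝓛)}` (`Eset`) is `Γ`-equivariant (`Eset_smul`), equals
  `⋃_{σ ∈ Stab(ℓ₀)} g₀ σ G₀` when `x_ℝ = g₀ · ℓ₀`, `ℓ₀ ∈ 𝓛` and is empty otherwise
  (`Eset_eq_biUnion`, `Eset_eq_empty`), so `μ(E(x)) = |Stab_{SL₂^±(ℝ)}(ℓ₀)| μ(G₀)` or `0`
  (`measure_Eset_eq`, `measure_Eset_dichotomy`; `|Stab| = 8, 4` by Lemma 2.2);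
* **unfolding** (`tsum_measure_inter_Eset_smul`): `∑_{γ ∈ Γ} μ(𝓕 ∩ E(γ • x)) = μ(E(x))`;
* **orbit–stabilizer regrouping** (`tsum_smul_eq`, `tsum_eq_tsum_orbits`);
* the counting function `N(g) = ∑_{x ∈ 𝒮} 1_{E(x)}(g)` (`countFn`) of a `Γ`-invariant set `𝒮`
  satisfies **`∫_𝓕 N dμ = ∑_{O ∈ Γ\𝒮} w(O)`** with
  `|Stab_Γ(x₀)| · w(Γ x₀) = μ(E(x₀))` (`lintegral_countFn_eq_tsum_orbits`,
  `encard_stabilizer_mul_orbitWeight`).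

Hence `∫_𝓕 N dμ = ∑_{O} 2nᵢ μ(G₀)/|Stab_Γ(O)|` over the orbits `O ⊂ 𝒮` meeting
`SL₂^±(ℝ) · 𝓛`, which is Bhargava–Shankar's (7) with their `1/|Stab|` weights.

## References

* M. Bhargava, A. Shankar, Ann. of Math. (2) 181 (2015) 191–242, §2.3, eqs. (5)–(7), Lemma 2.2
  (arXiv:1006.1002v2 numbering). [cite: BhargavaShankarAnnals2015, §2.3 (eqs. (5)–(7); arXiv:1006.1002v2 numbering)]
-/

noncomputable section

open Real MeasureTheory Matrix Set
open scoped MatrixGroups ENNReal Pointwise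

namespace Literature.NumberTheory.EllipticCurves

namespace BinaryQuartic

open Literature.MeasureTheory.Group

/-! ## `GL₂(ℤ) ⊂ GL₂(ℝ)` acting on integral forms -/

/-- The integral unit matrix underlying `γ ∈ GL₂(ℤ) ⊂ GL₂(ℝ)`. [folklore] -/
def intGL (γ : gl2zGL) : GL (Fin 2) ℤ := (exists_eq_map_of_mem γ).choose

/-- Its defining property. [folklore] -/
theorem coe_eq_map_intGL (γ : gl2zGL) :
    (γ : GL (Fin 2) ℝ) = Matrix.GeneralLinearGroup.map (Int.castRingHom ℝ) (intGL γ) :=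
  (exists_eq_map_of_mem γ).choose_spec

/-- The real matrix of `γ` is the cast of the integral matrix `intGL γ`. [folklore] -/
theorem coe_coe_eq_map_intGL (γ : gl2zGL) :
    ((γ : GL (Fin 2) ℝ) : Matrix (Fin 2) (Fin 2) ℝ) = ((intGL γ : GL (Fin 2) ℤ) : Matrix (Fin 2) (Fin 2) ℤ).map (Int.castRingHom ℝ) := by
  rw [coe_eq_map_intGL, coe_map_eq]

/-- `GL₂(ℤ) → GL₂(ℝ)` is injective. [folklore] -/
theorem gl2zMap_injective : Function.Injective (Matrix.GeneralLinearGroup.map (n := Fin 2) (Int.castRingHom ℝ)) := by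
  intro u v h
  apply Units.ext
  have h' := congrArg (fun w : GL (Fin 2) ℝ => (w : Matrix (Fin 2) (Fin 2) ℝ)) h
  simp only [coe_map_eq] at h'
  ext i j
  have := congrFun (congrFun h' i) j
  simpa [Matrix.map_apply] using this

/-- `intGL` is a group homomorphism. [folklore] -/
theorem intGL_mul (γ γ' : gl2zGL) : intGL (γ * γ') = intGL γ * intGL γ' := by
  apply gl2zMap_injective
  rw [map_mul, ← coe_eq_map_intGL, ← coe_eq_map_intGL, ← coe_eq_map_intGL, Subgroup.coe_mul]

/-- `intGL 1 = 1`. [folklore] -/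
theorem intGL_one : intGL (1 : gl2zGL) = 1 := by
  apply gl2zMap_injective
  rw [map_one, ← coe_eq_map_intGL, Subgroup.coe_one]

/-- The element of `gl2zGL` defined by an integral unit matrix. [folklore] -/
def ofIntGL (u : GL (Fin 2) ℤ) : gl2zGL := ⟨Matrix.GeneralLinearGroup.map (Int.castRingHom ℝ) u, u, rfl⟩

/-- `intGL (ofIntGL u) = u`. [folklore] -/
theorem intGL_ofIntGL (u : GL (Fin 2) ℤ) : intGL (ofIntGL u) = u :=
  gl2zMap_injective (by rw [← coe_eq_map_intGL]; rfl)

/-- **The substitution action of `GL₂(ℤ)` on integral binary quartic forms**, `γ • f = f ∘ γ`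
(`(f.subst γ)`, a left action since `f.subst (γ γ') = (f.subst γ').subst γ`). [cite: BhargavaShankarAnnals2015, §2 (the action of GL₂(ℤ) on V_ℤ; arXiv:1006.1002v2 numbering)] -/
instance mulActionGL2Z : MulAction gl2zGL (BinaryQuartic ℤ) where
  smul γ f := f.subst ((intGL γ : GL (Fin 2) ℤ) : Matrix (Fin 2) (Fin 2) ℤ)
  one_smul f := by
    show f.subst ((intGL 1 : GL (Fin 2) ℤ) : Matrix (Fin 2) (Fin 2) ℤ) = f
    rw [intGL_one, Units.val_one, subst_one]
  mul_smul γ γ' f := by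
    show f.subst ((intGL (γ * γ') : GL (Fin 2) ℤ) : Matrix (Fin 2) (Fin 2) ℤ) =
      (f.subst ((intGL γ' : GL (Fin 2) ℤ) : Matrix (Fin 2) (Fin 2) ℤ)).subst ((intGL γ : GL (Fin 2) ℤ) : Matrix (Fin 2) (Fin 2) ℤ)
    rw [intGL_mul, Units.val_mul, subst_mul]

/-- `γ • f = f.subst (intGL γ)`. [folklore] -/
theorem gl2z_smul_def (γ : gl2zGL) (f : BinaryQuartic ℤ) :
    γ • f = f.subst ((intGL γ : GL (Fin 2) ℤ) : Matrix (Fin 2) (Fin 2) ℤ) := rfl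

/-- The real form of `γ • f` is `f_ℝ ∘ γ_ℝ`. [folklore] -/
theorem map_gl2z_smul (γ : gl2zGL) (f : BinaryQuartic ℤ) :
    (γ • f).map (Int.castRingHom ℝ) = (f.map (Int.castRingHom ℝ)).subst ((γ : GL (Fin 2) ℝ) : Matrix (Fin 2) (Fin 2) ℝ) := by
  rw [gl2z_smul_def, map_subst, coe_coe_eq_map_intGL]

/-- **Orbits of this action are the `GL₂(ℤ)`-classes `gl2zOrbit`.** [folklore] -/
theorem orbit_eq_gl2zOrbit (f : BinaryQuartic ℤ) : MulAction.orbit gl2zGL f = gl2zOrbit f := by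
  ext g
  constructor
  · rintro ⟨γ, rfl⟩
    refine ⟨((intGL γ : GL (Fin 2) ℤ) : Matrix (Fin 2) (Fin 2) ℤ), ?_, rfl⟩
    rw [← Matrix.GeneralLinearGroup.val_det_apply]; exact Units.isUnit _
  · rintro ⟨γ, hγ, rfl⟩
    obtain ⟨d, hd⟩ := hγ
    let u : GL (Fin 2) ℤ := Matrix.GeneralLinearGroup.mk'' γ (by rw [← hd]; exact Units.isUnit d)
    refine ⟨ofIntGL u, ?_⟩
    show f.subst ((intGL (ofIntGL u) : GL (Fin 2) ℤ) : Matrix (Fin 2) (Fin 2) ℤ) = f.subst γ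
    rw [intGL_ofIntGL]
    rfl

/-! ## The sets `E(x) = {h ∈ SL₂^±(ℝ) : h⁻¹ · x_ℝ ∈ B(𝓛)}` -/

/-- `E(x) = {h : det h = ±1, h⁻¹ · x_ℝ ∈ avgSet 𝓛}`. [folklore] -/
def Eset (𝓛 : Set (BinaryQuartic ℝ)) (x : BinaryQuartic ℤ) : Set (Matrix (Fin 2) (Fin 2) ℝ) :=
  {h | (h.det = 1 ∨ h.det = -1) ∧ (x.map (Int.castRingHom ℝ)).subst h⁻¹ ∈ avgSet 𝓛}

/-- **Equivariance**: `E(γ • x) = γ • E(x)`. [folklore] -/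
theorem Eset_smul (𝓛 : Set (BinaryQuartic ℝ)) (γ : gl2zGL) (x : BinaryQuartic ℤ) :
    Eset 𝓛 (γ • x) = γ • Eset 𝓛 x := by
  have hγdet := det_coe_gl2zGL γ
  have hγu : IsUnit ((γ : GL (Fin 2) ℝ) : Matrix (Fin 2) (Fin 2) ℝ).det :=
    isUnit_iff_ne_zero.2 (by rcases hγdet with e | e <;> rw [e] <;> norm_num)
  ext h
  rw [Set.mem_smul_set]
  constructor
  · rintro ⟨hdet, hmem⟩
    refine ⟨((γ : GL (Fin 2) ℝ) : Matrix (Fin 2) (Fin 2) ℝ)⁻¹ * h, ⟨?_, ?_⟩, ?_⟩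
    · exact det_mul_of_det (det_inv_of_det hγdet) hdet
    · rw [map_gl2z_smul, ← subst_mul] at hmem
      rwa [Matrix.mul_inv_rev, Matrix.nonsing_inv_nonsing_inv _ hγu]
    · rw [gl2zGL_smul_def, Matrix.mul_nonsing_inv_cancel_left _ _ hγu]
  · rintro ⟨h', ⟨hdet', hmem'⟩, rfl⟩
    rw [gl2zGL_smul_def]
    refine ⟨det_mul_of_det hγdet hdet', ?_⟩
    rw [map_gl2z_smul, ← subst_mul, Matrix.mul_inv_rev, Matrix.nonsing_inv_mul_cancel_right _ _ hγu]
    exact hmem'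

/-! ## The structure of `E(x)`: a finite union of translates of `G₀`, or empty -/

/-- Hypotheses on the set of sections `𝓛`: its forms have `Δ ≠ 0` and are determined by their
invariants. [folklore] -/
structure IsSectionSet (𝓛 : Set (BinaryQuartic ℝ)) : Prop where
  /-- nonzero discriminant -/
  disc_ne : ∀ ℓ ∈ 𝓛, ℓ.disc ≠ 0
  /-- at most one form with given invariants -/
  uniq : ∀ ℓ ∈ 𝓛, ∀ ℓ' ∈ 𝓛, ℓ.I = ℓ'.I → ℓ.J = ℓ'.J → ℓ = ℓ'

/-- **`E(x) = ⋃_{σ ∈ Stab(ℓ₀)} g₀ σ G₀`** when `x_ℝ = g₀ · ℓ₀`, `ℓ₀ ∈ 𝓛`, `det g₀ = ±1`. [cite: BhargavaShankarAnnals2015, §2.3 (eqs. (6)–(7); arXiv:1006.1002v2 numbering)] -/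
theorem Eset_eq_biUnion {𝓛 : Set (BinaryQuartic ℝ)} (h𝓛 : IsSectionSet 𝓛) {x : BinaryQuartic ℤ}
    {ℓ₀ : BinaryQuartic ℝ} (hℓ₀ : ℓ₀ ∈ 𝓛) {g₀ : Matrix (Fin 2) (Fin 2) ℝ} (hg₀ : g₀.det = 1 ∨ g₀.det = -1)
    (hx : x.map (Int.castRingHom ℝ) = ℓ₀.subst g₀) :
    Eset 𝓛 x = ⋃ σ ∈ substStabilizer ℓ₀, (fun h' => g₀ * σ * h') '' G0 := by
  ext h
  simp only [Eset, mem_setOf_eq, mem_iUnion, mem_image, exists_prop]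
  constructor
  · rintro ⟨hdet, hmem⟩
    rw [hx] at hmem
    obtain ⟨σ, hσ, h', hh', rfl⟩ := (subst_inv_mem_avgSet_iff h𝓛.uniq hℓ₀ (h𝓛.disc_ne ℓ₀ hℓ₀) hg₀ hdet).1 hmem
    exact ⟨σ, hσ, h', hh', rfl⟩
  · rintro ⟨σ, hσ, h', hh', rfl⟩
    have hdetσ : σ.det = 1 ∨ σ.det = -1 := by
      have h2 := det_sq_eq_one_of_mem_substStabilizer (h𝓛.disc_ne ℓ₀ hℓ₀) hσ
      have hfac : (σ.det - 1) * (σ.det + 1) = 0 := by ring_nf; linarith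
      rcases mul_eq_zero.1 hfac with e | e
      · left; linarith
      · right; linarith
    have hdet : (g₀ * σ * h').det = 1 ∨ (g₀ * σ * h').det = -1 :=
      det_mul_of_det (det_mul_of_det hg₀ hdetσ) (Or.inl hh'.1)
    refine ⟨hdet, ?_⟩
    rw [hx]
    exact (subst_inv_mem_avgSet_iff h𝓛.uniq hℓ₀ (h𝓛.disc_ne ℓ₀ hℓ₀) hg₀ hdet).2 ⟨σ, hσ, h', hh', rfl⟩

/-- **`E(x) = ∅`** when `x_ℝ` is not `SL₂^±(ℝ)`-equivalent to a form of `𝓛`. [folklore] -/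
theorem Eset_eq_empty {𝓛 : Set (BinaryQuartic ℝ)} {x : BinaryQuartic ℤ}
    (hx : ¬ ∃ ℓ ∈ 𝓛, ∃ g : Matrix (Fin 2) (Fin 2) ℝ, (g.det = 1 ∨ g.det = -1) ∧ x.map (Int.castRingHom ℝ) = ℓ.subst g) :
    Eset 𝓛 x = ∅ := by
  ext h
  simp only [Eset, mem_setOf_eq, mem_empty_iff_false, iff_false, not_and]
  rintro hdet ⟨h', hh', ℓ, hℓ, heq⟩
  apply hx
  have hdh : IsUnit h.det := isUnit_iff_ne_zero.2 (by rcases hdet with e | e <;> rw [e] <;> norm_num)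
  refine ⟨ℓ, hℓ, h * h'⁻¹, det_mul_of_det hdet (det_inv_of_det (Or.inl hh'.1)), ?_⟩
  rw [subst_mul, ← heq, ← subst_mul, Matrix.mul_nonsing_inv _ hdh, subst_one]

/-- The real stabilizer of a form with `Δ ≠ 0` is finite (of size `8` or `4`). [folklore] -/
theorem finite_substStabilizer {ℓ : BinaryQuartic ℝ} (hΔ : ℓ.disc ≠ 0) : (substStabilizer ℓ).Finite := by
  apply Set.finite_of_ncard_ne_zero
  rcases lt_or_gt_of_ne hΔ with h | h
  · rw [ncard_substStabilizer_of_disc_neg h]; norm_num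
  · rw [ncard_substStabilizer_of_disc_pos h]; norm_num

section Measure

variable [MeasurableSpace (Matrix (Fin 2) (Fin 2) ℝ)] [BorelSpace (Matrix (Fin 2) (Fin 2) ℝ)]

/-- **`μ(E(x)) = |Stab(ℓ₀)| · μ(G₀)`** when `x_ℝ = g₀ · ℓ₀`. [cite: BhargavaShankarAnnals2015, §2.3 (eq. (7); arXiv:1006.1002v2 numbering)] -/
theorem measure_Eset_eq {𝓛 : Set (BinaryQuartic ℝ)} (h𝓛 : IsSectionSet 𝓛) {x : BinaryQuartic ℤ}
    {ℓ₀ : BinaryQuartic ℝ} (hℓ₀ : ℓ₀ ∈ 𝓛) {g₀ : Matrix (Fin 2) (Fin 2) ℝ} (hg₀ : g₀.det = 1 ∨ g₀.det = -1)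
    (hx : x.map (Int.castRingHom ℝ) = ℓ₀.subst g₀) :
    haarSL2pm (Eset 𝓛 x) = (substStabilizer ℓ₀).ncard * haarSL2pm G0 := by
  have hfin := finite_substStabilizer (h𝓛.disc_ne ℓ₀ hℓ₀)
  rw [Eset_eq_biUnion h𝓛 hℓ₀ hg₀ hx]
  have e : (⋃ σ ∈ substStabilizer ℓ₀, (fun h' => g₀ * σ * h') '' G0) =
      ⋃ σ ∈ hfin.toFinset, (fun h' => g₀ * σ * h') '' G0 := by
    ext h; simp only [mem_iUnion, Set.Finite.mem_toFinset]
  rw [e, haarSL2pm_biUnion_translates (h𝓛.disc_ne ℓ₀ hℓ₀) hg₀ hfin.toFinset (fun σ hσ => hfin.mem_toFinset.1 hσ),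
    Set.ncard_eq_toFinset_card _ hfin]

/-- `E(x)` is measurable. [folklore] -/
theorem measurableSet_Eset {𝓛 : Set (BinaryQuartic ℝ)} (h𝓛 : IsSectionSet 𝓛) (x : BinaryQuartic ℤ) :
    MeasurableSet (Eset 𝓛 x) := by
  by_cases hx : ∃ ℓ ∈ 𝓛, ∃ g : Matrix (Fin 2) (Fin 2) ℝ, (g.det = 1 ∨ g.det = -1) ∧ x.map (Int.castRingHom ℝ) = ℓ.subst g
  · obtain ⟨ℓ₀, hℓ₀, g₀, hg₀, hxe⟩ := hx
    rw [Eset_eq_biUnion h𝓛 hℓ₀ hg₀ hxe]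
    have hfin := finite_substStabilizer (h𝓛.disc_ne ℓ₀ hℓ₀)
    refine Set.Finite.measurableSet_biUnion hfin fun σ hσ => ?_
    have hdetσ : σ.det = 1 ∨ σ.det = -1 := by
      have h2 := det_sq_eq_one_of_mem_substStabilizer (h𝓛.disc_ne ℓ₀ hℓ₀) hσ
      have hfac : (σ.det - 1) * (σ.det + 1) = 0 := by ring_nf; linarith
      rcases mul_eq_zero.1 hfac with e | e
      · left; linarith
      · right; linarith
    exact measurableSet_image_mul_left (det_mul_of_det hg₀ hdetσ)
  · rw [Eset_eq_empty hx]; exact MeasurableSet.empty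

/-! ## Unfolding over `Γ = GL₂(ℤ)` -/

/-- `μ(F ∩ γ • A) = μ(γ⁻¹ • F ∩ A)` (left invariance of `μ` under `GL₂(ℤ)`). [folklore] -/
theorem measure_inter_smul (γ : gl2zGL) {F A : Set (Matrix (Fin 2) (Fin 2) ℝ)} (hF : MeasurableSet F)
    (hA : MeasurableSet A) : haarSL2pm (F ∩ γ • A) = haarSL2pm (γ⁻¹ • F ∩ A) := by
  have hγ := det_coe_gl2zGL γ
  have hγu : IsUnit ((γ : GL (Fin 2) ℝ) : Matrix (Fin 2) (Fin 2) ℝ).det :=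
    isUnit_iff_ne_zero.2 (by rcases hγ with e | e <;> rw [e] <;> norm_num)
  have e : γ⁻¹ • F ∩ A = (fun h => ((γ : GL (Fin 2) ℝ) : Matrix (Fin 2) (Fin 2) ℝ) * h) ⁻¹' (F ∩ γ • A) := by
    ext h
    simp only [mem_inter_iff, mem_preimage, Set.mem_smul_set, gl2zGL_smul_def]
    constructor
    · rintro ⟨⟨f, hf, rfl⟩, hh⟩
      refine ⟨?_, _, hh, rfl⟩
      rw [Subgroup.coe_inv, Matrix.coe_units_inv, Matrix.mul_nonsing_inv_cancel_left _ _ hγu]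
      exact hf
    · rintro ⟨hf, a, ha, hha⟩
      refine ⟨⟨_, hf, ?_⟩, ?_⟩
      · rw [Subgroup.coe_inv, Matrix.coe_units_inv, Matrix.nonsing_inv_mul_cancel_left _ _ hγu]
      · have := congrArg (fun M => ((γ : GL (Fin 2) ℝ) : Matrix (Fin 2) (Fin 2) ℝ)⁻¹ * M) hha
        simp only [Matrix.nonsing_inv_mul_cancel_left _ _ hγu] at this
        rw [← this]; exact ha
  rw [e, haarSL2pm_preimage_mul_left hγ (hF.inter (hA.const_smul γ))]

/-- **Unfolding**: `∑_{γ ∈ Γ} μ(F ∩ E(γ • x)) = μ(E(x))` for the fundamental domain `F` of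
`GL₂(ℤ)` (`E(γ • x) = γ E(x)`, invariance of `μ`, and `∑_γ μ(γ F ∩ A) = μ(A)`). [cite: BhargavaShankarAnnals2015, §2.3 (eqs. (5)–(7); arXiv:1006.1002v2 numbering)] -/
theorem tsum_measure_inter_Eset_smul {𝓛 : Set (BinaryQuartic ℝ)} (h𝓛 : IsSectionSet 𝓛) (x : BinaryQuartic ℤ) :
    ∑' γ : gl2zGL, haarSL2pm (gaussFD ∩ Eset 𝓛 (γ • x)) = haarSL2pm (Eset 𝓛 x) := by
  have hE := measurableSet_Eset h𝓛 x
  calc ∑' γ : gl2zGL, haarSL2pm (gaussFD ∩ Eset 𝓛 (γ • x))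
      = ∑' γ : gl2zGL, haarSL2pm (γ⁻¹ • gaussFD ∩ Eset 𝓛 x) := by
        refine tsum_congr fun γ => ?_
        rw [Eset_smul, measure_inter_smul γ measurableSet_gaussFD hE]
    _ = ∑' γ : gl2zGL, haarSL2pm (γ • gaussFD ∩ Eset 𝓛 x) := (Equiv.inv gl2zGL).tsum_eq
        (fun γ => haarSL2pm (γ • gaussFD ∩ Eset 𝓛 x))
    _ = haarSL2pm (Eset 𝓛 x) := by
        rw [isFundamentalDomain_gaussFD.measure_eq_tsum' (Eset 𝓛 x)]
        exact tsum_congr fun γ => by rw [inter_comm]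

end Measure

/-! ## Orbit–stabilizer regrouping -/

/-- The fibre `{γ : γ • x = y}` over a point of the orbit is a coset of the stabilizer. [folklore] -/
theorem fiber_eq_image_stabilizer {x : BinaryQuartic ℤ} {γ₀ : gl2zGL} :
    {γ : gl2zGL | γ • x = γ₀ • x} = (fun s => γ₀ * s) '' (MulAction.stabilizer gl2zGL x : Set gl2zGL) := by
  ext γ
  simp only [mem_setOf_eq, mem_image, SetLike.mem_coe, MulAction.mem_stabilizer_iff]
  constructor
  · intro h
    refine ⟨γ₀⁻¹ * γ, ?_, by group⟩
    rw [mul_smul, h, inv_smul_smul]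
  · rintro ⟨s, hs, rfl⟩
    rw [mul_smul, hs]

/-- **`∑_{γ ∈ Γ} f(γ • x) = |Stab_Γ(x)| · ∑_{y ∈ Γ x} f(y)`** (in `ℝ≥0∞`, with `|Stab|` as an
extended natural number). [folklore] -/
theorem tsum_smul_eq (f : BinaryQuartic ℤ → ℝ≥0∞) (x : BinaryQuartic ℤ) :
    ∑' γ : gl2zGL, f (γ • x) =
      (MulAction.stabilizer gl2zGL x : Set gl2zGL).encard * ∑' y : MulAction.orbit gl2zGL x, f y := by
  let pr : gl2zGL → MulAction.orbit gl2zGL x := fun γ => ⟨γ • x, MulAction.mem_orbit _ _⟩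
  rw [← ENNReal.tsum_fiberwise (fun γ => f (γ • x)) pr, ← ENNReal.tsum_mul_left]
  refine tsum_congr fun y => ?_
  obtain ⟨y, γ₀, rfl⟩ := y
  have hfib : pr ⁻¹' {⟨γ₀ • x, MulAction.mem_orbit _ _⟩} = {γ : gl2zGL | γ • x = γ₀ • x} := by
    ext γ; simp [pr]
  have hconst : ∀ γ : ↥(pr ⁻¹' {⟨γ₀ • x, MulAction.mem_orbit _ _⟩}), f ((γ : gl2zGL) • x) = f (γ₀ • x) := by
    rintro ⟨γ, hγ⟩
    rw [hfib] at hγ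
    simp only [mem_setOf_eq] at hγ
    rw [hγ]
  rw [tsum_congr hconst, ENNReal.tsum_set_const, hfib, fiber_eq_image_stabilizer,
    (mul_right_injective γ₀).injOn.encard_image]

/-- Distinct `GL₂(ℤ)`-orbits are disjoint. [folklore] -/
theorem pairwiseDisjoint_orbits (𝒮 : Set (BinaryQuartic ℤ)) :
    (gl2zOrbit '' 𝒮).PairwiseDisjoint id := by
  rintro O ⟨x, -, rfl⟩ O' ⟨x', -, rfl⟩ hne
  rw [Function.onFun, Set.disjoint_left]
  intro z hz hz'
  apply hne
  change z ∈ gl2zOrbit x at hz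
  change z ∈ gl2zOrbit x' at hz'
  rw [← orbit_eq_gl2zOrbit] at hz hz' ⊢
  rw [← orbit_eq_gl2zOrbit]
  rw [← MulAction.orbit_eq_iff.2 hz, ← MulAction.orbit_eq_iff.2 hz']

/-- A `Γ`-invariant set is the union of the orbits of its elements. [folklore] -/
theorem eq_biUnion_orbits {𝒮 : Set (BinaryQuartic ℤ)} (h𝒮 : ∀ (γ : gl2zGL) (x : BinaryQuartic ℤ), x ∈ 𝒮 → γ • x ∈ 𝒮) :
    𝒮 = ⋃ O ∈ gl2zOrbit '' 𝒮, id O := by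
  ext z
  simp only [mem_iUnion, mem_image, id, exists_prop]
  constructor
  · intro hz
    exact ⟨gl2zOrbit z, ⟨z, hz, rfl⟩, by rw [← orbit_eq_gl2zOrbit]; exact MulAction.mem_orbit_self z⟩
  · rintro ⟨_, ⟨x, hx, rfl⟩, hz⟩
    rw [← orbit_eq_gl2zOrbit] at hz
    obtain ⟨γ, rfl⟩ := hz
    exact h𝒮 γ x hx

/-- **Regrouping a sum over a `Γ`-invariant set by orbits.** [folklore] -/
theorem tsum_eq_tsum_orbits {𝒮 : Set (BinaryQuartic ℤ)} (h𝒮 : ∀ (γ : gl2zGL) (x : BinaryQuartic ℤ), x ∈ 𝒮 → γ • x ∈ 𝒮)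
    (w : BinaryQuartic ℤ → ℝ≥0∞) :
    ∑' x : 𝒮, w x = ∑' O : ↥(gl2zOrbit '' 𝒮), ∑' x : ↥(O : Set (BinaryQuartic ℤ)), w x := by
  have hU := eq_biUnion_orbits h𝒮
  rw [← (Equiv.setCongr hU).symm.tsum_eq (fun x => w x)]
  simp only [Equiv.setCongr_symm_apply]
  exact ENNReal.tsum_biUnion' (pairwiseDisjoint_orbits 𝒮)

/-! ## The unfolded integral -/

/-- Integral binary quartic forms are countable. [folklore] -/
instance countable_binaryQuartic_int : Countable (BinaryQuartic ℤ) :=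
  (coeffs_injective (R := ℤ)).countable

section Measure

variable [MeasurableSpace (Matrix (Fin 2) (Fin 2) ℝ)] [BorelSpace (Matrix (Fin 2) (Fin 2) ℝ)]

/-- The lattice-point counting function of the averaging method:
`N(g) = #{x ∈ 𝒮 : g⁻¹ · x_ℝ ∈ B(𝓛)} = ∑_{x ∈ 𝒮} 1_{E(x)}(g)` (as an extended nonnegative real).
[cite: BhargavaShankarAnnals2015, §2.3 (eq. (5): N(V^{(i)};X) as an average of #{x ∈ gF ∩ V^{irr}}; arXiv:1006.1002v2 numbering)] -/
def countFn (𝓛 : Set (BinaryQuartic ℝ)) (𝒮 : Set (BinaryQuartic ℤ)) (g : Matrix (Fin 2) (Fin 2) ℝ) : ℝ≥0∞ :=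
  ∑' x : 𝒮, (Eset 𝓛 x).indicator 1 g

/-- The weight of an orbit: `∑_{x ∈ O} μ(F ∩ E(x))`. [folklore] -/
def orbitWeight (𝓛 : Set (BinaryQuartic ℝ)) (O : Set (BinaryQuartic ℤ)) : ℝ≥0∞ :=
  ∑' x : O, haarSL2pm (gaussFD ∩ Eset 𝓛 x)

/-- **The averaging integral, unfolded by orbits**:
`∫_F N(g) dμ(g) = ∑_{O ∈ Γ\𝒮} ∑_{x ∈ O} μ(F ∩ E(x))` for a `Γ`-invariant set `𝒮` of integral
forms. [cite: BhargavaShankarAnnals2015, §2.3 (eqs. (5)–(7); arXiv:1006.1002v2 numbering)] -/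
theorem lintegral_countFn_eq_tsum_orbits {𝓛 : Set (BinaryQuartic ℝ)} (h𝓛 : IsSectionSet 𝓛)
    {𝒮 : Set (BinaryQuartic ℤ)} (h𝒮 : ∀ (γ : gl2zGL) (x : BinaryQuartic ℤ), x ∈ 𝒮 → γ • x ∈ 𝒮) :
    ∫⁻ g in gaussFD, countFn 𝓛 𝒮 g ∂haarSL2pm = ∑' O : ↥(gl2zOrbit '' 𝒮), orbitWeight 𝓛 (O : Set (BinaryQuartic ℤ)) := by
  unfold countFn orbitWeight
  rw [lintegral_tsum fun x : ↥𝒮 => ((measurable_one.indicator (measurableSet_Eset h𝓛 (x : BinaryQuartic ℤ))).aemeasurable)]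
  have e : ∀ x : ↥𝒮, ∫⁻ g in gaussFD, (Eset 𝓛 (x : BinaryQuartic ℤ)).indicator 1 g ∂haarSL2pm =
      haarSL2pm (gaussFD ∩ Eset 𝓛 x) := by
    intro x
    rw [lintegral_indicator_one (measurableSet_Eset h𝓛 _), Measure.restrict_apply (measurableSet_Eset h𝓛 _),
      inter_comm]
  rw [tsum_congr e]
  exact tsum_eq_tsum_orbits h𝒮 (fun x => haarSL2pm (gaussFD ∩ Eset 𝓛 x))

/-- **The weight of an orbit**: `|Stab_Γ(x₀)| · ∑_{x ∈ Γ x₀} μ(F ∩ E(x)) = μ(E(x₀))`. [cite: BhargavaShankarAnnals2015, §2.3 (eqs. (6)–(7), the factor 1/|Stab|; arXiv:1006.1002v2 numbering)] -/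
theorem encard_stabilizer_mul_orbitWeight {𝓛 : Set (BinaryQuartic ℝ)} (h𝓛 : IsSectionSet 𝓛) (x₀ : BinaryQuartic ℤ) :
    (MulAction.stabilizer gl2zGL x₀ : Set gl2zGL).encard * orbitWeight 𝓛 (gl2zOrbit x₀) =
      haarSL2pm (Eset 𝓛 x₀) := by
  rw [← tsum_measure_inter_Eset_smul h𝓛 x₀,
    tsum_smul_eq (fun y => haarSL2pm (gaussFD ∩ Eset 𝓛 y)) x₀, orbitWeight]
  congr 1
  exact (Equiv.setCongr (orbit_eq_gl2zOrbit x₀)).symm.tsum_eq (fun y => haarSL2pm (gaussFD ∩ Eset 𝓛 y))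

/-- **`μ(E(x₀)) = 2nᵢ μ(G₀)` or `0`**: if `x₀,ℝ = g₀ · ℓ₀` with `ℓ₀ ∈ 𝓛` then
`μ(E(x₀)) = |Stab_{SL₂^±(ℝ)}(ℓ₀)| μ(G₀)` (`= 8 μ(G₀)` for `Δ > 0`, `4 μ(G₀)` for `Δ < 0`,
Lemma 2.2), and otherwise `E(x₀) = ∅`. [cite: BhargavaShankarAnnals2015, §2.3 (eq. (7)) and Lemma 2.2 (arXiv:1006.1002v2 numbering)] -/
theorem measure_Eset_dichotomy {𝓛 : Set (BinaryQuartic ℝ)} (h𝓛 : IsSectionSet 𝓛) (x : BinaryQuartic ℤ) :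
    (∃ ℓ₀ ∈ 𝓛, ∃ g₀ : Matrix (Fin 2) (Fin 2) ℝ, (g₀.det = 1 ∨ g₀.det = -1) ∧
        x.map (Int.castRingHom ℝ) = ℓ₀.subst g₀ ∧
        haarSL2pm (Eset 𝓛 x) = (substStabilizer ℓ₀).ncard * haarSL2pm G0) ∨
      haarSL2pm (Eset 𝓛 x) = 0 := by
  by_cases hx : ∃ ℓ ∈ 𝓛, ∃ g : Matrix (Fin 2) (Fin 2) ℝ, (g.det = 1 ∨ g.det = -1) ∧ x.map (Int.castRingHom ℝ) = ℓ.subst g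
  · obtain ⟨ℓ₀, hℓ₀, g₀, hg₀, hxe⟩ := hx
    exact Or.inl ⟨ℓ₀, hℓ₀, g₀, hg₀, hxe, measure_Eset_eq h𝓛 hℓ₀ hg₀ hxe⟩
  · right; rw [Eset_eq_empty hx, measure_empty]

end Measure

end BinaryQuartic

end Literature.NumberTheory.EllipticCurves

end
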